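import Mathlib
import Summits.NavierStokesRegularity.NavierStokesRegularity.Theorems.EulerZoomLiouvillePowerGaugeEulerLiouvilleCondenserSharpPacking

/-!
# THE PACKED CONDENSER ON A PRESCRIBED HEIGHT SET (plate P_w, steps (1)–(6); nsreg-p2 g35 ROUND-45 `r45/Sketch45c.lean`,
ref3 SCORE-p2-ROUND-45 F5 «separated on most heights»)

Width piece for crux `EulerZoomLiouville.PowerGaugeEulerLiouville` (stmt-NavierStokesRegularity-19832), by name under
LEAD 19832 (ns-typeII-p2 g13); seat ns-sfl-p1 g6, `--supports stmt-NavierStokesRegularity-19832 --as helper`.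
The `…CondenserSharpPacking` forms (t47-P) with the height range `[R, Λ'R]` replaced by a prescribed set `T ⊆ [R, Λ'R]`:
the quiet-slice step is an ABSTRACT SELECTOR `hQT` on `T` (instantiated by name, e.g. with ns-ezl-w2 g4's
`Condenser.weightedQuietSlice_on`), and the `2r`-separation of the `N` segments is only required at the common heights
`s ∈ T`.

* `exists_slice_packing_alternative_of_crossings_on` — STATIC FORM on `T` with abstract slice budgets `A_T`, `E_T s`;
* `exists_slice_packing_alternative_of_segments_on` — DYNAMIC FORM on `T` (first hits, `exists_anomalous_plane_of_exit`).

HONEST FRAMING: real analysis in `ℝ³` (with a cut-off flow); nothing here proves the crux E (19832 OPEN), any door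
Target, or any Navier–Stokes statement; no summit statement is touched. [folklore; cite: ConstantinIgnatovaVicol2026Putative,
§3.4.1 for the setting]
-/

noncomputable section

open Set Filter Topology Metric Function MeasureTheory Real
open scoped RealInnerProductSpace

set_option linter.dupNamespace false

namespace Summit.NavierStokesRegularity.NavierStokesRegularity.Theorems.PowerGaugeEulerLiouville.Condenser

open Literature.Analysis Literature.Analysis.FluidPDE

/-- **THE PACKED CONDENSER ON A PRESCRIBED HEIGHT SET, STATIC FORM (P_w steps (2)–(6)).**  See the module docstring;
`hQT` is an abstract quiet-slice selector on the height set `T` (e.g. ns-ezl-w2 g4's `Condenser.weightedQuietSlice_on`). [folklore (length–area method);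
cite: ConstantinIgnatovaVicol2026Putative, §3.4.1 for the setting] -/
theorem exists_slice_packing_alternative_of_crossings_on
    {V : EuclideanSpace ℝ (Fin 3) → EuclideanSpace ℝ (Fin 3)} (hV : ContDiff ℝ 1 V)
    {e : EuclideanSpace ℝ (Fin 3)} (he : ‖e‖ = 1) {N : ℕ} (hN : 1 ≤ N)
    {γ R Λ Λ' δ r X Y Gm AT : ℝ} {ET : ℝ → ℝ} {T : Set ℝ} (hγ : 0 < γ) (hR : 0 < R) (hT : T ⊆ Icc R (Λ' * R))
    (hδ : 0 < δ) (hδ1 : δ < 1) (hr : 0 < r) (hr2 : r ≤ R / 2) (hET : ∀ s ∈ T, 0 < ET s)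
    (hQT : ∀ (F G : EuclideanSpace ℝ (Fin 3) → ℝ), Continuous F → Continuous G → (∀ x, 0 ≤ F x) → (∀ x, 0 ≤ G x) →
      (∫ x in ball (0 : EuclideanSpace ℝ (Fin 3)) ((Λ + 1) * R), F x ≤ X) →
      (∫ x in ball (0 : EuclideanSpace ℝ (Fin 3)) ((Λ + 1) * R), G x ≤ Y) →
      ∃ s ∈ T, ∫ a, (ball (0 : EuclideanSpace ℝ (Fin 3)) ((Λ + 1) * R)).indicator F (plane s a) ≤ AT ∧
        ∫ a, (ball (0 : EuclideanSpace ℝ (Fin 3)) ((Λ + 1) * R)).indicator G (plane s a) ≤ ET s)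
    (hA : ∫ x in ball (0 : EuclideanSpace ℝ (Fin 3)) ((Λ + 1) * R), ‖V x‖ ^ 2 ≤ X)
    (hE : ∫ x in ball (0 : EuclideanSpace ℝ (Fin 3)) ((Λ + 1) * R), ‖fderiv ℝ V x‖ ^ 2 ≤ Y)
    (hGm : ∀ z ∈ ball (0 : EuclideanSpace ℝ (Fin 3)) ((Λ + 1) * R), ‖fderiv ℝ V z‖ ≤ Gm)
    (hcross : ∀ s ∈ T, ∃ p : Fin N → EuclideanSpace ℝ (Fin 3),
      (∀ i, ⟪p i, e⟫ = s) ∧ (∀ i, ‖p i‖ ≤ Λ * R) ∧ (∀ i, ⟪V (p i), e⟫ ≤ -(γ * s)) ∧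
      (∀ i j, i ≠ j → 2 * r < ‖p i - p j‖)) :
    ∃ s ∈ T,
      (1 - δ) * (γ * s) ≤ Real.sqrt (2 * AT / Real.pi) / r ∨
        δ * (γ * s) / r *
            Real.exp (N * (2 * Real.pi * ((1 - δ) * (γ * s) - Real.sqrt (2 * AT / Real.pi) / r) ^ 2) / ET s) ≤ Gm := by
  -- rotate `e` to `e₂`
  set e₂ : EuclideanSpace ℝ (Fin 3) := EuclideanSpace.basisFun (Fin 3) ℝ 2 with he₂
  have he₂1 : ‖e₂‖ = 1 := (EuclideanSpace.basisFun (Fin 3) ℝ).orthonormal.1 2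
  obtain ⟨Rot, hRot⟩ := exists_linearIsometryEquiv_apply_eq he he₂1
  set W : EuclideanSpace ℝ (Fin 3) → EuclideanSpace ℝ (Fin 3) := fun z => V (Rot.symm z) with hW
  have hWc : ContDiff ℝ 1 W := hV.comp Rot.symm.toContinuousLinearEquiv.contDiff
  have hWd : Differentiable ℝ W := hWc.differentiable one_ne_zero
  have hDW : ∀ x, ‖fderiv ℝ W x‖ = ‖fderiv ℝ V (Rot.symm x)‖ := norm_fderiv_comp_linearIsometryEquiv V Rot
  have hA' : ∫ x in ball (0 : EuclideanSpace ℝ (Fin 3)) ((Λ + 1) * R), ‖W x‖ ^ 2 ≤ X := by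
    have h := setIntegral_ball_comp_linearIsometryEquiv (fun x => ‖V x‖ ^ 2) Rot ((Λ + 1) * R)
    simp only [hW]
    rw [h]; exact hA
  have hE' : ∫ x in ball (0 : EuclideanSpace ℝ (Fin 3)) ((Λ + 1) * R), ‖fderiv ℝ W x‖ ^ 2 ≤ Y := by
    have h := setIntegral_ball_comp_linearIsometryEquiv (fun x => ‖fderiv ℝ V x‖ ^ 2) Rot ((Λ + 1) * R)
    simp_rw [hDW]
    rw [h]; exact hE
  -- a quiet slice on the prescribed height set `T`
  obtain ⟨s, hs, hFs, hGs⟩ := hQT (fun x => ‖W x‖ ^ 2) (fun x => ‖fderiv ℝ W x‖ ^ 2)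
    (hWc.continuous.norm.pow 2) ((hWc.continuous_fderiv one_ne_zero).norm.pow 2)
    (fun x => sq_nonneg _) (fun x => sq_nonneg _) hA' hE'
  refine ⟨s, hs, ?_⟩
  have hsR : R ≤ s := (hT hs).1
  have hspos : 0 < s := hR.trans_le hsR
  have hm : 0 < γ * s := mul_pos hγ hspos
  -- the `N` points on it, rotated, and their chart coordinates
  obtain ⟨p, hpe, hpn, hpV, hpsep⟩ := hcross s hs
  have hp'2 : ∀ i, (Rot (p i)) 2 = s := fun i => by
    rw [← EuclideanSpace.inner_basisFun_real (x := Rot (p i)) (i := 2), ← he₂, ← hRot, Rot.inner_map_map, hpe i]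
  have hp'n : ∀ i, ‖Rot (p i)‖ ≤ Λ * R := fun i => by rw [Rot.norm_map]; exact hpn i
  -- ONE chart of the plane `{x 2 = s}` at the base point `s•e₂`
  set y₀ : EuclideanSpace ℝ (Fin 3) := s • EuclideanSpace.basisFun (Fin 3) ℝ 2 with hy₀
  have hy₀2 : y₀ 2 = s := by simp [hy₀, EuclideanSpace.basisFun_apply]
  set zc : Fin N → ℂ := fun i => ⟨(Rot (p i)) 0, (Rot (p i)) 1⟩ with hzc
  have hΦz : ∀ i, y₀ + (zc i).re • EuclideanSpace.basisFun (Fin 3) ℝ 0 + (zc i).im • EuclideanSpace.basisFun (Fin 3) ℝ 1 =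
      Rot (p i) := fun i => cchart_base_apply (hp'2 i)
  have hzdist : ∀ i j, ‖zc i - zc j‖ = ‖p i - p j‖ := by
    intro i j
    rw [← norm_cchart_sub_cchart y₀ (zc i) (zc j), hΦz i, hΦz j, ← map_sub, Rot.norm_map]
  have hzinj : Function.Injective zc := by
    intro i j hij
    by_contra hne
    have h := hpsep i j hne
    rw [← hzdist i j, hij, sub_self, norm_zero] at h
    linarith
  -- ONE scalar: `ψ = ⟪W∘Φ, −e⟫` (values are not rotated, so `ψ(zᵢ) = −⟪V pᵢ, e⟫`)
  have hu1 : ‖-e‖ = 1 := by rw [norm_neg, he]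
  set ψ : ℂ → ℝ := fun z =>
    ⟪W (y₀ + z.re • EuclideanSpace.basisFun (Fin 3) ℝ 0 + z.im • EuclideanSpace.basisFun (Fin 3) ℝ 1), -e⟫ with hψ
  have hψc : ContDiff ℝ 1 ψ := contDiff_comp_cchart (f := fun x => ⟪W x, -e⟫) (hWc.inner ℝ contDiff_const) y₀
  have hψz : ∀ i, γ * s ≤ ψ (zc i) := by
    intro i
    have h1 : ψ (zc i) = -⟪V (p i), e⟫ := by
      simp only [hψ]
      rw [hΦz i, hW]
      simp only [LinearIsometryEquiv.symm_apply_apply, inner_neg_right]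
    rw [h1]; linarith [hpV i]
  -- the centres as a `Finset ℂ` of card `N`
  set S : Finset ℂ := Finset.univ.image zc with hSdef
  have hScard : S.card = N := by
    rw [hSdef, Finset.card_image_of_injective _ hzinj, Finset.card_univ, Fintype.card_fin]
  have hSne : S.Nonempty := by
    rw [← Finset.card_pos, hScard]; exact hN
  have hmemS : ∀ q ∈ S, ∃ i, zc i = q := fun q hq => by
    simpa [hSdef] using hq
  -- discs around the centres fit in `B(0,(Λ+1)R)`
  have hfit : ∀ i, ∀ w ∈ closedBall (zc i) r,
      ‖y₀ + w.re • EuclideanSpace.basisFun (Fin 3) ℝ 0 + w.im • EuclideanSpace.basisFun (Fin 3) ℝ 1‖ < (Λ + 1) * R := by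
    intro i w hw
    rw [mem_closedBall, dist_eq_norm] at hw
    have h1 := norm_cchart_sub_cchart y₀ w (zc i)
    have h2 : ‖y₀ + w.re • EuclideanSpace.basisFun (Fin 3) ℝ 0 + w.im • EuclideanSpace.basisFun (Fin 3) ℝ 1‖ ≤
        ‖(y₀ + w.re • EuclideanSpace.basisFun (Fin 3) ℝ 0 + w.im • EuclideanSpace.basisFun (Fin 3) ℝ 1) -
          (y₀ + (zc i).re • EuclideanSpace.basisFun (Fin 3) ℝ 0 + (zc i).im • EuclideanSpace.basisFun (Fin 3) ℝ 1)‖ +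
        ‖y₀ + (zc i).re • EuclideanSpace.basisFun (Fin 3) ℝ 0 + (zc i).im • EuclideanSpace.basisFun (Fin 3) ℝ 1‖ :=
      norm_le_norm_sub_add _ _
    rw [h1, hΦz i] at h2
    nlinarith [hp'n i]
  -- (P₀ i) floors at the centres
  have hmS : ∀ q ∈ S, γ * s ≤ ψ q := by
    intro q hq; obtain ⟨i, rfl⟩ := hmemS q hq; exact hψz i
  -- (P₀ ii) separation
  have hsepS : ∀ q ∈ S, ∀ q' ∈ S, q ≠ q' → 2 * r < ‖q - q'‖ := by
    intro q hq q' hq' hne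
    obtain ⟨i, rfl⟩ := hmemS q hq
    obtain ⟨j, rfl⟩ := hmemS q' hq'
    have hij : i ≠ j := fun h => hne (by rw [h])
    rw [hzdist i j]; exact hpsep i j hij
  -- (P₀ iii) gradient bound on the discs
  have hGS : ∀ q ∈ S, ∀ w ∈ closedBall q r, ‖fderiv ℝ ψ w‖ ≤ Gm := by
    intro q hq w hw
    obtain ⟨i, rfl⟩ := hmemS q hq
    refine (norm_fderiv_inner_comp_cchart_le hWd hu1.le y₀ w).trans ?_
    rw [hDW]
    apply hGm
    rw [mem_ball, dist_zero_right, Rot.symm.norm_map]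
    exact hfit i w hw
  -- (P₀ iv) amplitude budget per disc
  have hAS : ∀ q ∈ S, ∫ w in closedBall q r, ψ w ^ 2 ≤ AT := by
    intro q hq
    obtain ⟨i, rfl⟩ := hmemS q hq
    have h := setIntegral_cchart_sq_inner_le hWc hu1.le (isCompact_closedBall (zc i) r) (hfit i)
    rw [hy₀2] at h
    exact h.trans hFs
  -- (P₀ v) energy budget on the union of the discs
  have hUc : IsCompact (⋃ q ∈ S, closedBall q r) := S.isCompact_biUnion fun q _ => isCompact_closedBall q r
  have hfitU : ∀ w ∈ ⋃ q ∈ S, closedBall q r,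
      ‖y₀ + w.re • EuclideanSpace.basisFun (Fin 3) ℝ 0 + w.im • EuclideanSpace.basisFun (Fin 3) ℝ 1‖ < (Λ + 1) * R := by
    intro w hw
    simp only [mem_iUnion] at hw
    obtain ⟨q, hq, hwq⟩ := hw
    obtain ⟨i, rfl⟩ := hmemS q hq
    exact hfit i w hwq
  have hEU : ∫ w in ⋃ q ∈ S, closedBall q r, ‖fderiv ℝ ψ w‖ ^ 2 ≤ ET s := by
    have h := setIntegral_cchart_sq_norm_fderiv_inner_le hWc hu1.le hUc hfitU
    rw [hy₀2] at h
    exact h.trans hGs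
  -- the packed circular-mean core (t47-P₀)
  have h := circleMeanCondenserPacking ψ S (γ * s) Gm AT _ r δ hψc hSne hm hr hδ hδ1 (hET s hs)
    hmS hsepS hGS hAS hEU
  rw [hScard] at h
  exact h

/-- **THE PACKED CONDENSER ON A PRESCRIBED HEIGHT SET, DYNAMIC FORM (P_w steps (1)–(6)).**  As
`exists_slice_packing_alternative_of_crossings_on`, the crossings being supplied by `N` backward similarity orbit
segments of the cut-off flow (`‖DV‖ ≤ K`) from `B(0,R)`, inside `B̄(0,ΛR)`, with caps `⟪Ψ_{Lᵢ} yᵢ, e⟫ ≥ Λ'R`, which are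
`2r`-separated only at the common heights `s ∈ T`; the points are the FIRST HITS (`exists_anomalous_plane_of_exit`).
[folklore; cite: ConstantinIgnatovaVicol2026Putative, §3.4.1 for the setting] -/
theorem exists_slice_packing_alternative_of_segments_on
    {γ : ℝ} {V : EuclideanSpace ℝ (Fin 3) → EuclideanSpace ℝ (Fin 3)} (hV : ContDiff ℝ 1 V)
    {K : ℝ} (hK : ∀ y, ‖fderiv ℝ V y‖ ≤ K)
    {e : EuclideanSpace ℝ (Fin 3)} (he : ‖e‖ = 1) {N : ℕ} (hN : 1 ≤ N)
    {R Λ Λ' δ r X Y Gm AT : ℝ} {ET : ℝ → ℝ} {T : Set ℝ} (hγ : 0 < γ) (hR : 0 < R) (hT : T ⊆ Icc R (Λ' * R))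
    (hδ : 0 < δ) (hδ1 : δ < 1) (hr : 0 < r) (hr2 : r ≤ R / 2) (hET : ∀ s ∈ T, 0 < ET s)
    (hQT : ∀ (F G : EuclideanSpace ℝ (Fin 3) → ℝ), Continuous F → Continuous G → (∀ x, 0 ≤ F x) → (∀ x, 0 ≤ G x) →
      (∫ x in ball (0 : EuclideanSpace ℝ (Fin 3)) ((Λ + 1) * R), F x ≤ X) →
      (∫ x in ball (0 : EuclideanSpace ℝ (Fin 3)) ((Λ + 1) * R), G x ≤ Y) →
      ∃ s ∈ T, ∫ a, (ball (0 : EuclideanSpace ℝ (Fin 3)) ((Λ + 1) * R)).indicator F (plane s a) ≤ AT ∧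
        ∫ a, (ball (0 : EuclideanSpace ℝ (Fin 3)) ((Λ + 1) * R)).indicator G (plane s a) ≤ ET s)
    (hA : ∫ x in ball (0 : EuclideanSpace ℝ (Fin 3)) ((Λ + 1) * R), ‖V x‖ ^ 2 ≤ X)
    (hE : ∫ x in ball (0 : EuclideanSpace ℝ (Fin 3)) ((Λ + 1) * R), ‖fderiv ℝ V x‖ ^ 2 ≤ Y)
    (hGm : ∀ z ∈ ball (0 : EuclideanSpace ℝ (Fin 3)) ((Λ + 1) * R), ‖fderiv ℝ V z‖ ≤ Gm)
    {y : Fin N → EuclideanSpace ℝ (Fin 3)} {L : Fin N → ℝ} (hL : ∀ i, 0 ≤ L i) (hy : ∀ i, ‖y i‖ < R)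
    (hstay : ∀ i, ∀ t ∈ Icc 0 (L i),
      ‖ODE.evolutionMap (fun _ : ℝ => selfSimilarTransport γ 0 V) 0 (-t) (y i)‖ ≤ Λ * R)
    (hcap : ∀ i, Λ' * R ≤ ⟪ODE.evolutionMap (fun _ : ℝ => selfSimilarTransport γ 0 V) 0 (-(L i)) (y i), e⟫)
    (hsep : ∀ s ∈ T, ∀ i j, i ≠ j → ∀ t ∈ Icc 0 (L i), ∀ t' ∈ Icc 0 (L j),
      ⟪ODE.evolutionMap (fun _ : ℝ => selfSimilarTransport γ 0 V) 0 (-t) (y i), e⟫ = s →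
      ⟪ODE.evolutionMap (fun _ : ℝ => selfSimilarTransport γ 0 V) 0 (-t') (y j), e⟫ = s →
      2 * r < ‖ODE.evolutionMap (fun _ : ℝ => selfSimilarTransport γ 0 V) 0 (-t) (y i) -
        ODE.evolutionMap (fun _ : ℝ => selfSimilarTransport γ 0 V) 0 (-t') (y j)‖) :
    ∃ s ∈ T,
      (1 - δ) * (γ * s) ≤ Real.sqrt (2 * AT / Real.pi) / r ∨
        δ * (γ * s) / r *
            Real.exp (N * (2 * Real.pi * ((1 - δ) * (γ * s) - Real.sqrt (2 * AT / Real.pi) / r) ^ 2) / ET s) ≤ Gm := by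
  refine exists_slice_packing_alternative_of_crossings_on hV he hN hγ hR hT hδ hδ1 hr hr2 hET hQT hA hE hGm ?_
  intro s hsT
  have hs : s ∈ Icc R (Λ' * R) := hT hsT
  -- first hit of the plane `⟪·,e⟫ = s` by every segment
  have hfirst : ∀ i, ∃ σ ∈ Ioc (0 : ℝ) (L i),
      ⟪ODE.evolutionMap (fun _ : ℝ => selfSimilarTransport γ 0 V) 0 (-σ) (y i), e⟫ = s ∧
      ⟪V (ODE.evolutionMap (fun _ : ℝ => selfSimilarTransport γ 0 V) 0 (-σ) (y i)), e⟫ ≤ -(γ * s) := by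
    intro i
    have hys : ⟪y i, e⟫ < s := by
      have h1 : ⟪y i, e⟫ ≤ ‖y i‖ * ‖e‖ := real_inner_le_norm (y i) e
      rw [he, mul_one] at h1
      linarith [hs.1, hy i]
    have hexit : s ≤ ⟪ODE.evolutionMap (fun _ : ℝ => selfSimilarTransport γ 0 V) 0 (-(L i)) (y i), e⟫ :=
      hs.2.trans (hcap i)
    obtain ⟨σ, hσ, heq, hVe, -⟩ := exists_anomalous_plane_of_exit (γ := γ) hV hK he (hL i) hys hexit
    exact ⟨σ, hσ, heq, hVe⟩
  choose σ hσ hσeq hσV using hfirst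
  refine ⟨fun i => ODE.evolutionMap (fun _ : ℝ => selfSimilarTransport γ 0 V) 0 (-(σ i)) (y i),
    hσeq, fun i => hstay i (σ i) ⟨(hσ i).1.le, (hσ i).2⟩, hσV, ?_⟩
  intro i j hij
  exact hsep s hsT i j hij (σ i) ⟨(hσ i).1.le, (hσ i).2⟩ (σ j) ⟨(hσ j).1.le, (hσ j).2⟩ (hσeq i) (hσeq j)

end Summit.NavierStokesRegularity.NavierStokesRegularity.Theorems.PowerGaugeEulerLiouville.Condenser

end
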